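import Summits.FinalStateConjecture.FinalStateConjecture.Theorems.SwallowTheDatumParametricKerrBurialCollarLine
import Summits.FinalStateConjecture.FinalStateConjecture.Theorems.SwallowTheDatumParametricKerrBurialCollarDilation

/-!
# Stub `stub_collarDilationB` of the line `null-shell-shadow-collar` (crux
# `SwallowTheDatum.ParametricKerrBurial`, item stmt-FinalStateConjecture-10052): the dilates of a
# collar are collars

The COLLAR DILATION stub of the second collar line (`SwallowTheDatumParametricKerrBurialCollarLine.lean`,
`IsCollar l μ C`): from one collar `C` at scale `1` — vacuum outside the unit ball, isotropic
Schwarzschild(`μ`) on the annulus `{1 < ‖y‖ < 2}`, exactly isotropic Schwarzschild(`M_end`) beyond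
`R_end`, Kerr-shielded by a chart ranging in `{2 < ‖y‖}` — the DILATES
`C_l := C.dilate l = ((y ↦ y/l)^* C).homothety l` (`InitialDataDilation.lean`; Cartesian
components `h_l(y) = h(y/l)`, `k_l(y) = l⁻¹ k(y/l)`), `l > 0`, form a family (`C.dilateFamily`) with
sections jointly smooth on `{0 < l} × E3` (`SmoothSectionsOn`) all of whose members are collars at
scale `l` with the same `μ` (`IsCollar l μ (C_l)`):
* vacuum on `{l < ‖y‖}`: diffeomorphism equivariance and homothety covariance of the constraint
  map (`hamiltonianConstraintFn_comap`, `momentumConstraintFn_comap_apply`,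
  `hamiltonianConstraintFn_homothety`, `momentumConstraintFn_homothety`; Bartnik–Isenberg 2004 §2);
* the isotropic end and the annulus formula: `M/(2‖y/l‖) = lM/(2‖y‖)`;
* the shield: the first collar line's `CollarDilation.isKerrShieldedAway_dilate`
  (`SwallowTheDatumParametricKerrBurialCollarDilation.lean`: dilates of located Kerr shields are
  located Kerr shields — Kerr–Schild homogeneity and the homothety covariance `K' = l⁻¹ K` of the
  second fundamental form, `ChartSecondFundamentalFormDilation.lean`).
The family is extended by the junk value `C` for `l ≤ 0` (never evaluated there); its joint
smoothness is the tree's `contMDiffAt_dilateFamily_h/_k`.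
References: Bartnik–Isenberg 2004 §2; Misner–Thorne–Wheeler 1973 (31.22); the line card
`Cruxes/ParametricKerrBurial/Lines/null-shell-shadow-collar.md`.
-/

-- `Summit.<Summit>.<Problem>` is the tree's mandated summit-side namespace (CONVENTIONS §2); for this
-- single-conjunct summit the two coincide, so the duplicate is deliberate.
set_option linter.dupNamespace false

noncomputable section

-- instance search through the nested operator types `E3 →L E3 →L ℝ` (as in `ConstraintFamilies`)
set_option maxSynthPendingDepth 3

namespace Summit.FinalStateConjecture.FinalStateConjecture.Theorems.SwallowTheDatum.ParametricKerrBurial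

open scoped Manifold ContDiff Topology
open Bundle Set Filter Function Literature.Geometry.Lorentzian

/-! ## The stub -/

/-- **Stub `stub_collarDilationB`: the dilates of a collar are collars.** From a collar `C` at
scale `1` with annulus mass parameter `μ`, the dilates `C_l = ((y ↦ y/l)^* C).homothety l`
(`h_l(y) = h(y/l)`, `k_l(y) = l⁻¹ k(y/l)`, junk `C` for `l ≤ 0`) form a family with sections jointly
smooth on `{0 < l} × E3` whose members are collars at scale `l`: vacuum outside the ball of radius `l`
(equivariance and homothety covariance of the constraints, Bartnik–Isenberg 2004 §2), isotropic
Schwarzschild(`l M_end`) beyond `l R_end`, the annulus formula with the same `μ` on `{l < ‖y‖ < 2l}`,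
and Kerr-shielded beyond `2l` (`CollarDilation.isKerrShieldedAway_dilate`). [folklore] -/
theorem stub_collarDilationB : ∀ [Kerr.Facts] (C : InitialDataSet (𝓡 3) E3) (μ : ℝ), 0 < μ → IsCollar 1 μ C → ∃ Cfam : ℝ → InitialDataSet (𝓡 3) E3, SmoothSectionsOn 𝓘(ℝ, ℝ) Cfam {p : ℝ × E3 | 0 < p.1} ∧ ∀ l : ℝ, 0 < l → IsCollar l μ (Cfam l) := by
  intro _ C μ hμ hC
  obtain ⟨hvac, ⟨Mend, Rend, hMend, hRend, hiso⟩, hann, hsh⟩ := hC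
  -- the Cartesian components of the dilates (`InitialDataDilation.lean`)
  have hhE : ∀ (l : ℝ) (hl : 0 < l) (x : E3),
      ((C.dilate l hl).h.inner x : E3 →L[ℝ] E3 →L[ℝ] ℝ) = C.h.inner (l⁻¹ • x) := fun l hl x ↦ by
    ext v w; exact C.dilate_h_inner l hl x v w
  have hkE : ∀ (l : ℝ) (hl : 0 < l) (x : E3),
      ((C.dilate l hl).k x : E3 →L[ℝ] E3 →L[ℝ] ℝ) = l⁻¹ • C.k (l⁻¹ • x) := fun l hl x ↦ by
    ext v w; exact C.dilate_k l hl x v w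
  -- the scalar bookkeeping `M/(2‖x/l‖) = lM/(2‖x‖)`
  have hnorm : ∀ (l : ℝ), 0 < l → ∀ x : E3, ‖l⁻¹ • x‖ = l⁻¹ * ‖x‖ := fun l hl x ↦ by
    rw [norm_smul, Real.norm_eq_abs, abs_of_pos (inv_pos.2 hl)]
  have hfrac : ∀ (l : ℝ), 0 < l → ∀ (m : ℝ) (x : E3), x ≠ 0 →
      m / (2 * ‖l⁻¹ • x‖) = l * m / (2 * ‖x‖) := fun l hl m x hx ↦ by
    have hx' : ‖x‖ ≠ 0 := norm_ne_zero_iff.2 hx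
    rw [hnorm l hl]
    field_simp
  refine ⟨C.dilateFamily, ⟨fun p hp ↦ (C.contMDiffAt_dilateFamily_h hp).contMDiffWithinAt,
    fun p hp ↦ (C.contMDiffAt_dilateFamily_k hp).contMDiffWithinAt⟩, fun l hl ↦ ⟨?_, ?_, ?_, ?_⟩⟩
  · -- vacuum outside the ball of radius `l`
    rw [C.dilateFamily_of_pos hl]
    intro inst y hy
    haveI hC' : C.metric.HasLeviCivita := C.metric.hasLeviCivita
    haveI hCc : (C.comap (InitialDataSet.shrinkCLM l) (InitialDataSet.contMDiff_shrinkCLM l)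
        (InitialDataSet.injective_mfderiv_shrinkCLM hl.ne')).metric.HasLeviCivita :=
      (C.comap (InitialDataSet.shrinkCLM l) (InitialDataSet.contMDiff_shrinkCLM l)
        (InitialDataSet.injective_mfderiv_shrinkCLM hl.ne')).metric.hasLeviCivita
    haveI : ((C.comap (InitialDataSet.shrinkCLM l) (InitialDataSet.contMDiff_shrinkCLM l)
        (InitialDataSet.injective_mfderiv_shrinkCLM hl.ne')).homothety l hl).metric.HasLeviCivita :=
      inst
    have hy' : InitialDataSet.shrinkCLM l y ∈ {y : E3 | 1 < ‖y‖} := by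
      show 1 < ‖l⁻¹ • y‖
      rw [hnorm l hl, lt_inv_mul_iff₀ hl, mul_one]
      exact hy
    obtain ⟨hH, hM⟩ := hvac (InitialDataSet.shrinkCLM l y) hy'
    change ((C.comap (InitialDataSet.shrinkCLM l) (InitialDataSet.contMDiff_shrinkCLM l)
        (InitialDataSet.injective_mfderiv_shrinkCLM hl.ne')).homothety l hl).hamiltonianConstraintFn
          y = 0 ∧
      ((C.comap (InitialDataSet.shrinkCLM l) (InitialDataSet.contMDiff_shrinkCLM l)
        (InitialDataSet.injective_mfderiv_shrinkCLM hl.ne')).homothety l hl).momentumConstraintFn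
          y = 0
    refine ⟨?_, ?_⟩
    · rw [InitialDataSet.hamiltonianConstraintFn_homothety,
        InitialDataSet.hamiltonianConstraintFn_comap C (InitialDataSet.contMDiff_shrinkCLM l)
          (InitialDataSet.injective_mfderiv_shrinkCLM hl.ne') rfl, hH, mul_zero]
    · rw [InitialDataSet.momentumConstraintFn_homothety]
      refine smul_eq_zero_of_right _ (LinearMap.ext fun Y₀ ↦ ?_)
      rw [InitialDataSet.momentumConstraintFn_comap_apply C (InitialDataSet.contMDiff_shrinkCLM l)
        (InitialDataSet.injective_mfderiv_shrinkCLM hl.ne') rfl y (C.mdifferentiableAt_traceK _),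
        hM]
      rfl
  · -- the isotropic end `(l M_end, l R_end)`
    refine ⟨l * Mend, l * Rend, mul_nonneg hl.le hMend, mul_pos hl hRend, fun y hy ↦ ?_⟩
    have hy0 : y ≠ 0 := by
      rintro rfl; rw [norm_zero] at hy; linarith [mul_pos hl hRend]
    have hy' : Rend < ‖l⁻¹ • y‖ := by
      rw [hnorm l hl, lt_inv_mul_iff₀ hl]; exact hy
    obtain ⟨h1, h2⟩ := hiso (l⁻¹ • y) hy'
    rw [C.dilateFamily_of_pos hl]
    refine ⟨?_, ?_⟩
    · rw [hhE l hl y, h1, hfrac l hl Mend y hy0]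
      rfl
    · rw [hkE l hl y, h2, smul_zero]
      rfl
  · -- the annulus formula at scale `l`
    intro y hy1 hy2
    have hy0 : y ≠ 0 := by
      rintro rfl; rw [norm_zero] at hy1; linarith
    have hy1' : 1 < ‖l⁻¹ • y‖ := by
      rw [hnorm l hl, lt_inv_mul_iff₀ hl, mul_one]; exact hy1
    have hy2' : ‖l⁻¹ • y‖ < 2 * 1 := by
      rw [hnorm l hl, inv_mul_lt_iff₀ hl]; linarith
    obtain ⟨h1, h2⟩ := hann (l⁻¹ • y) hy1' hy2'
    rw [C.dilateFamily_of_pos hl]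
    refine ⟨?_, ?_⟩
    · rw [hhE l hl y, h1, one_mul, hfrac l hl μ y hy0]
      rfl
    · rw [hkE l hl y, h2, smul_zero]
      rfl
  · -- the shield beyond `2 l` (the first collar line's shield dilation)
    rw [C.dilateFamily_of_pos hl, show 2 * l = l * (2 * 1) by ring]
    exact CollarDilation.isKerrShieldedAway_dilate C hl hsh

end Summit.FinalStateConjecture.FinalStateConjecture.Theorems.SwallowTheDatum.ParametricKerrBurial

end
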